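import Summits.Ventures.CertifiedManyBodySolver.Rows.TorusCeilingCRT
import HarnessLib

/-!
# Torus ceiling — Part V-b: the TILTED 16-site torus `ℤ²/⟨(4,0),(1,4)⟩` as the circulant ring `ℤ/16`

HONEST FRAMING: first certified bounds; not a superconductivity verdict; every number certified or
labelled float.
Besides `4 × 4 = (ℤ/4)²`, the square lattice has exactly two more 16-site period lattices on which
every window of extent `≤ 4 × 4` embeds (no non-zero lattice vector in `[-3, 3]²`), up to the symmetries
of the square: `Λ₁₆′ = ⟨(4,0),(1,4)⟩` and `Λ₁₆″ = ⟨(4,0),(2,4)⟩`. The first has cyclic quotient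
`ℤ²/Λ₁₆′ = ℤ/16` (`(x, y) ↦ 12x + y`, i.e. `y − 4x (mod 16)`), so its nearest-neighbour Hubbard model is
the circulant RING `ℤ/16` with hops `{±1, ±4}` (not bipartite) and it is literally an instance of Part V's
`ringHom`: `tiltHom16 = ringHom 16 ![12, 1]`. This file specialises Part IV
(`homTorus_minEnergyOn_div_ge_of_window_certificate`) to it: every square-lattice window certificate
whose window has coordinate spreads `≤ 3, ≤ 3` (the `(4,4)` class, e.g. reduce-mode certificates of
support box `4 × 4`) bounds the `S^z = 0` ground-energy density of `homHubbard tiltHom16 t U`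
(`tilt16_minEnergyOn_div_ge_of_window_certificate`). Use: a certified exact upper bound on a
`(7,7)`-sector (or any `S^z = 0`) ground energy of this 16-site tilted torus caps the `(4,4)` window
class exactly as the `4 × 4` rows do. (`Λ₁₆″` has quotient `ℤ/2 × ℤ/8`, not of the form `(ℤ/N)^{d'}`
with a surjective lattice map; it is not treated here.)

References: Han 2020 §3; Kull–Schuch–Dive–Navascués 2024 §5.3 (translation-averaged window
relaxations are blind to the global identification of the period lattice). [cite: Han2020Bootstrap, §3]
[cite: KullEtAl2024, §5.3]
-/

noncomputable section

open Matrix Finset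
open Literature.MathematicalPhysics.QuantumLattice
open Literature.MathematicalPhysics.QuantumFieldTheory hiding Site
open Literature.MathematicalPhysics.QuantumManyBody.StateRelaxation
open Literature.Probability.LatticeModels
open HubbardWave0
open scoped ComplexOrder ComplexConjugate

namespace Summit.Ventures.CertifiedManyBodySolver.Rows

section Tilt16

/-- **Ring presentation of the tilted torus `ℤ²/⟨(4,0),(1,4)⟩`**: `ℤ² →+ ℤ/16`, `x ↦ 12x₀ + x₁`
(`e₀ ↦ 12 = −4`, `e₁ ↦ 1`; kernel `⟨(4,0),(1,4)⟩` since the map is onto and kills both generators);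
`homHubbard tiltHom16 t U` is the nearest-neighbour Hubbard model of this 16-site tilted torus written on
the ring `ℤ/16` with hops `{±4, ±1}`. [folklore] -/
def tiltHom16 : Site 2 →+ TorusSite 1 16 := ringHom 16 ![12, 1]

/-- The two generators of `Λ₁₆′ = ⟨(4,0),(1,4)⟩` lie in the kernel of `tiltHom16`. [folklore] -/
theorem tiltHom16_generators : tiltHom16 ![4, 0] = 0 ∧ tiltHom16 ![1, 4] = 0 := by
  refine ⟨?_, ?_⟩ <;> funext j <;>
    simp only [tiltHom16, ringHom_apply, Fin.sum_univ_two, Matrix.cons_val_zero, Matrix.cons_val_one,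
      Pi.zero_apply] <;> decide

/-- **Window certificate ⇒ the tilted 16-site torus `ℤ²/⟨(4,0),(1,4)⟩` (kernel).** A square-lattice
window certificate (`hubbardFermionInteraction 2 t U`, data of
`groundEnergyAt_div_ge_of_window_certificate`) whose window `Λ'` has coordinate spreads `≤ 3` and `≤ 3`
bounds the `S^z = 0` ground-energy density of the Hubbard model on the tilted torus in its ring
presentation `homHubbard tiltHom16 t U` (ring `ℤ/16`, hops `{±1, ±4}`), every `n ≤ 16`:
`c − Σ‖aₖ‖ + (Σ_σ μ_σ)(n/16 − ν) ≤ minEnergyOn (szSector 2n 0) / 16`. Window injectivity is the finite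
fact "`16 ∣ 12a + b`, `|a| ≤ 3`, `|b| ≤ 3` ⇒ `a = b = 0`" (`omega`); hop non-degeneracy is
"`±12, ±1` pairwise distinct mod `16`" (`decide`). [cite: Han2020Bootstrap, §3] -/
theorem tilt16_minEnergyOn_div_ge_of_window_certificate (t U : ℝ) {nh : ℕ}
    (hn : nh ≤ Fintype.card (FermionTorus 1 16))
    {Λ Λ' : Finset (Site 2)} (hΛ : Λ ⊆ Λ')
    (hspread : ∀ x ∈ Λ', ∀ y ∈ Λ', |x 0 - y 0| ≤ (3 : ℤ) ∧ |x 1 - y 1| ≤ (3 : ℤ))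
    (hclosed : ∀ x ∈ Λ, ∀ i : Fin 2, x + unitVec i ∈ Λ' ∧ x - unitVec i ∈ Λ')
    (h0 : thicken ({0} : Finset (Site 2)) 1 ⊆ Λ') (hz : (0 : Site 2) ∈ Λ')
    (μ : Fin 2 → ℝ) (ν : ℝ)
    {m : Type*} [Fintype m] [DecidableEq m] {Λm : Matrix m m ℂ} (hΛm : Λm.PosSemidef)
    (O : m → FermionOp Λ')
    {κ : Type*} (s : Finset κ) (B : κ → FermionOp Λ)
    {ι : Type*} (tt : Finset ι) (v : ι → Site 2) (hsh : ∀ l, shiftSet (v l) Λ ⊆ Λ') (Y : ι → FermionOp Λ)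
    {γ : Type*} (u : Finset γ) (b : γ → ℂ) (cw : γ → List (Orb (PolySite Λ') × Bool))
    (hcw : ∀ j ∈ u, ladderCharge (cw j) ≠ 0 ∨ ladderSpinCharge (cw j) ≠ 0)
    {δ : Type*} (ah : Finset δ) (dc : δ → ℝ) (V : δ → FermionOp Λ')
    {κ'' : Type*} (w : Finset κ'') (a : κ'' → ℂ) (word : κ'' → List (Orb (PolySite Λ') × Bool)) {c : ℝ}
    (hcert : fermionEmbed (PolySite.incl h0) ((hubbardFermionInteraction 2 t U).meanEnergyObs 1) -
        (c : ℂ) • (1 : FermionOp Λ') -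
        ∑ σ : Fin 2, ((μ σ : ℝ) : ℂ) • (nAt 0 hz σ - ((ν : ℝ) : ℂ) • (1 : FermionOp Λ')) =
      gramForm Λm O +
        (∑ k ∈ s, ((hubbardFermionInteraction 2 t U).localHamiltonian Λ' * fermionEmbed (PolySite.incl hΛ) (B k) -
            fermionEmbed (PolySite.incl hΛ) (B k) * (hubbardFermionInteraction 2 t U).localHamiltonian Λ') +
          ∑ l ∈ tt, (fermionEmbed (PolySite.incl (hsh l)) (fermionEmbed (PolySite.shiftEmb (v l) Λ) (Y l)) -
            fermionEmbed (PolySite.incl hΛ) (Y l)) +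
          ∑ j ∈ u, b j • ladderWord (cw j)) +
        (∑ m' ∈ ah, ((dc m' : ℝ) : ℂ) • ((V m')ᴴ - V m') + ∑ k ∈ w, a k • ladderWord (word k))) :
    c - ∑ k ∈ w, ‖a k‖ + (∑ σ : Fin 2, μ σ) * ((nh : ℝ) / 16 - ν) ≤
      (homHubbard tiltHom16 t U).minEnergyOn (szSector (2 * nh) 0) / 16 := by
  have hInj' : Set.InjOn tiltHom16 ↑Λ' :=
    injOn_ringHom_two_of_spread 16 ![12, 1] (M₀ := 3) (M₁ := 3)
      (fun a' b' h₁ h₂ h₃ h₄ h₅ => by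
        simp only [Matrix.cons_val_zero, Matrix.cons_val_one] at h₅
        omega) hspread
  have hd : Function.Injective (signedHop tiltHom16) := injective_signedHop_ringHom 16 ![12, 1] (by decide)
  have h := homTorus_minEnergyOn_div_ge_of_window_certificate tiltHom16 t U hd hn hΛ hclosed h0 hz hInj' μ ν
    hΛm O s B tt v hsh Y u b cw hcw ah dc V w a word hcert
  simp only [Nat.cast_ofNat, pow_one] at h
  exact h

end Tilt16

end Summit.Ventures.CertifiedManyBodySolver.Rows

end
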